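import Literature.NumberTheory.Sieve.SmoothParityHcCrude
import Literature.NumberTheory.Sieve.SmoothParityMajorArcs
import Literature.NumberTheory.Sieve.SmoothParityMajorArcsFlatTools
import Literature.NumberTheory.Sieve.SmoothSaddleScaleCompare
import HarnessLib

/-!
# Parity-class friable ternary counts: the major arcs in flat form

Topic `Literature/NumberTheory/Sieve`, namespace `Literature.NumberTheory.Sieve.SmoothArcs`; a PROVED bookkeeping sequel
of `SmoothParityMajorArcs` ([Harper2016, §5], [LagariasSoundararajan2012]).  `parity_major_arcs` bounds
`‖Σ_{r major} V₁V₂V̄₃ − N₀·𝔖·parityModelCount‖` by an explicit `ERR` built from the data of the three variables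
(`Mv_i = e_i^{−α}𝓜`, `S_i ≤ ‖c_i‖_W`, `X_i = x/e_i`, the lattice factor `LAT`, the off-arc factor `OFF`, the flat
errors `C₁, C₂`, the two arithmetic sums `𝓗₃(R)`, `𝓗⁺(R)` and the tail of `𝔖`).  Here `ERR` is flattened to
`e₃ · Mv₁Mv₂Mv₃ · F` with a SCALAR `F` depending only on uniform bounds: `‖c_i‖_W ≤ P`, `𝓗₃(R) ≤ H`, `e_i ≤ e_B`,
`d_i ≤ D`, `x ≤ N₀ ≤ 2x`, `1 − 10⁻⁴ ≤ α ≤ 1`, a lower bound `G₀ ≤ 𝓜`, an upper bound `φ₂(α, y) ≤ Φ`, and majorants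
`Δ, W ≤ 1` of the relative flat errors:

`F = P³H(331η(28 + 16 log 2e_B) + 100(e_B/(3R) + 8D(1 + 2e_B(1 + log 2x))/x)) + 2316R(3(11P+1)²ΔH + 375(11P+2)²WR⁸)`
`    + 48D²P³(R+1)^{−1/6}`

(`parity_major_arcs_flat`; `𝓗⁺(R) ≤ R²(1+4R²)³` by `parityHcSumPlus_le`, `#S(X_i, y) ≤ e_i^{−α}x^αζ(α,y)` by Rankin at
the master saddle point, `|log(X₃/N₀)|, |log(d₁X₁/N₀)| ≤ log 2e_B`, the tail factor `≤ 24D²(R+1)^{−1/6}` for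
`α ≥ 1 − 10⁻⁴`).  Every term of `F` tends to `0` along the polylog regime with `R, Λ` powers of `log x`; that limit is
taken in the companion file `SmoothParityAsymptotic`; the elementary factor bounds are in `SmoothParityMajorArcsFlatTools`.

## References

* A. J. Harper, Compositio Math. 152 (2016), §5 [Harper2016].
* J. C. Lagarias, K. Soundararajan, Proc. LMS 104 (2012), Thm 1.3 [LagariasSoundararajan2012].
-/

noncomputable section

open Finset Real Complex
open scoped FourierTransform

namespace Literature.NumberTheory.Sieve

namespace SmoothArcs

open TwistedWeight Vinogradov
open scoped Classical

/-! ### The major arcs, flat form -/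

set_option maxHeartbeats 1600000 in
/-- **THE MAJOR ARCS of the parity-class friable ternary count, flat form.**  Under the hypotheses of
`parity_major_arcs` and the uniform bounds `‖c_i‖_W ≤ P`, `𝓗₃(R) ≤ H`, `e_i ≤ e_B ≤ x`, `1 ≤ d_i ≤ D`, `x ≤ N₀ ≤ 2x`,
`1 − 10⁻⁴ ≤ α`, `0 < G₀ ≤ 𝓜`, `φ₂(α,y) ≤ Φ`, `12(1+Λ)Pe_B/x + 16P/Λ³ ≤ Δ ≤ 1`,
`2RC_F x^{1/2+ε₀}(2R)^{ε₀}(1+Λ)³Pe_B/G₀ + 16√(2πΦ)P/Λ³ ≤ W ≤ 1`: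
`‖Σ_{r major} V₁(d₁r/N₀)V₂(σd₂r/N₀)V̄₃(r/N₀) − N₀·𝔖·parityModelCount‖ ≤ e₃ · Mv₁Mv₂Mv₃ · F` with the scalar `F` of the
module docstring. [cite: Harper2016, §5] [cite: LagariasSoundararajan2012, Thm 1.3 (shape)] -/
theorem parity_major_arcs_flat {x : ℝ} {y : ℕ} (hx : 1 < x) (hy : 2 ≤ y) (hα : 13 / 15 < saddlePoint x y)
    (hα1 : saddlePoint x y ≤ 1) (hα4 : 1 - 1 / 10000 ≤ saddlePoint x y)
    {Λ η E ε₀ C_F : ℝ} (hΛ : 0 < Λ) (hη0 : 0 ≤ η) (hη1 : η ≤ 1) (hε₀ : 0 < ε₀) (hC : 0 ≤ C_F)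
    (hW : ∀ e' : ℕ, 1 ≤ e' → (e' : ℝ) ≤ E → ∀ lam : ℝ, |lam| ≤ Λ →
      ‖(∑ n ∈ Nat.smoothNumbersUpTo ⌊x / e'⌋₊ (y + 1), twistWeight lam (n / (x / e'))) -
          ((((e' : ℝ) ^ (-saddlePoint x y) * (x ^ saddlePoint x y * smoothZeta (saddlePoint x y) y /
              Real.sqrt (2 * Real.pi * saddlePhi₂ (saddlePoint x y) y)) : ℝ)) : ℂ) * twistMellin lam (saddlePoint x y)‖ ≤
        (e' : ℝ) ^ (-saddlePoint x y) * (η * (x ^ saddlePoint x y * smoothZeta (saddlePoint x y) y /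
          Real.sqrt (2 * Real.pi * saddlePhi₂ (saddlePoint x y) y)) / (1 + |lam|)))
    (hF : ∀ (q : ℕ) (χ : DirichletCharacter ℂ q), q ≠ 0 → χ ≠ 1 → ∀ (y : ℕ) (X lam : ℝ), 1 ≤ X →
      ‖∑ n ∈ Nat.smoothNumbersUpTo ⌊X⌋₊ (y + 1), χ (n : ZMod q) * twistWeight lam (n / X)‖ ≤
        C_F * (1 + |lam|) ^ 3 * X ^ (1 / 2 + ε₀) * (q : ℝ) ^ ε₀)
    {e₁ e₂ e₃ d₁ d₂ : ℕ} {σ : ℤ} (hσ : σ = 1 ∨ σ = -1) (he₁ : 1 ≤ e₁) (he₂ : 1 ≤ e₂) (he₃ : 1 ≤ e₃)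
    {eB : ℝ} (heB₁ : (e₁ : ℝ) ≤ eB) (heB₂ : (e₂ : ℝ) ≤ eB) (heB₃ : (e₃ : ℝ) ≤ eB) (heBx : eB ≤ x)
    (hΛ₁ : Λ ≤ x / e₁) (hΛ₂ : Λ ≤ x / e₂) (hΛ₃ : Λ ≤ x / e₃)
    (hd₁1 : 1 ≤ d₁) (hd₂1 : 1 ≤ d₂) (hd₁e : Even d₁) (hd₂o : Odd d₂) {D : ℝ} (hd₁D : (d₁ : ℝ) ≤ D) (hd₂D : (d₂ : ℝ) ≤ D)
    (hd₁ : (d₁ : ℝ) * (x / e₁) ≤ x) (hd₂ : (d₂ : ℝ) * (x / e₂) ≤ x)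
    {N₀ : ℕ} (hN : (d₁ : ℝ) * (x / e₁) + (d₂ : ℝ) * (x / e₂) + x / e₃ < N₀) (hcop : Nat.Coprime d₁ N₀)
    (hxN : x ≤ N₀) (hN2 : (N₀ : ℝ) ≤ 2 * x)
    {R : ℕ} (hR2 : 2 ≤ R) (hRy : R ≤ y) (hRx : 400 * (R : ℝ) ^ 3 < x) (hxRN : x ≤ 96 * R * N₀)
    (hΛR : 192 * (R : ℝ) ≤ Λ)
    (hE₁ : ((e₁ * (2 * R) ^ 2 : ℕ) : ℝ) ≤ E) (hE₂ : ((e₂ * (2 * R) ^ 2 : ℕ) : ℝ) ≤ E) (hE₃ : ((e₃ * R ^ 2 : ℕ) : ℝ) ≤ E)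
    {c₁ c₂ c₃ : ℤ → ℂ} (hc₁ : Summable (fun ℓ : ℤ => ‖c₁ ℓ‖ * (1 + |(ℓ : ℝ)|) ^ 3))
    (hc₂ : Summable (fun ℓ : ℤ => ‖c₂ ℓ‖ * (1 + |(ℓ : ℝ)|) ^ 3))
    (hc₃ : Summable (fun ℓ : ℤ => ‖c₃ ℓ‖ * (1 + |(ℓ : ℝ)|) ^ 3))
    {P : ℝ} (hP₁ : profileNorm c₁ ≤ P) (hP₂ : profileNorm c₂ ≤ P) (hP₃ : profileNorm c₃ ≤ P)
    {H : ℝ} (hH : ∑ k ∈ Icc 1 R, ∑ a ∈ (Finset.range k).filter (Nat.Coprime k),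
      classLocalHc (saddlePoint x y) 2 1 k (d₁ * a) * classLocalHc (saddlePoint x y) 2 1 k (σ * (d₂ * a)) *
        classLocalHc (saddlePoint x y) 1 0 k a ≤ H)
    {G₀ : ℝ} (hG₀ : 0 < G₀) (hGM : G₀ ≤ x ^ saddlePoint x y * smoothZeta (saddlePoint x y) y /
      Real.sqrt (2 * Real.pi * saddlePhi₂ (saddlePoint x y) y))
    {Φ : ℝ} (hΦ : saddlePhi₂ (saddlePoint x y) y ≤ Φ)
    {Δ W : ℝ} (hΔ : 12 * (1 + Λ) * P * eB / x + 16 * P / Λ ^ 3 ≤ Δ) (hΔ1 : Δ ≤ 1)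
    (hWW : 2 * R * C_F * x ^ (1 / 2 + ε₀) * (2 * R : ℝ) ^ ε₀ * (1 + Λ) ^ 3 * P * eB / G₀ +
      16 * Real.sqrt (2 * Real.pi * Φ) * P / Λ ^ 3 ≤ W) (hW1 : W ≤ 1) :
    ‖(∑ r ∈ (Finset.range N₀).filter (fun r : ℕ => ∃ k : ℕ, 1 ≤ k ∧ k ≤ R ∧ ∃ a : ℕ, a < k ∧ Nat.Coprime k a ∧
          distInt ((r : ℝ) / N₀ - (a : ℝ) / k) ≤ 96 * R / x),
        classProfileSum (x / e₁) y 2 1 c₁ ((d₁ : ℝ) * ((r : ℝ) / N₀)) *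
          classProfileSum (x / e₂) y 2 1 c₂ ((σ : ℝ) * d₂ * ((r : ℝ) / N₀)) *
          starRingEnd ℂ (classProfileSum (x / e₃) y 1 0 c₃ ((r : ℝ) / N₀))) -
        (N₀ : ℂ) * paritySingSeries (saddlePoint x y) σ d₁ d₂ *
          parityModelCount σ d₁ d₂ (x / e₁) (x / e₂) (x / e₃) ((e₁ : ℝ) ^ (-saddlePoint x y) * (x ^ saddlePoint x y * smoothZeta (saddlePoint x y) y /
            Real.sqrt (2 * Real.pi * saddlePhi₂ (saddlePoint x y) y))) ((e₂ : ℝ) ^ (-saddlePoint x y) * (x ^ saddlePoint x y * smoothZeta (saddlePoint x y) y /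
            Real.sqrt (2 * Real.pi * saddlePhi₂ (saddlePoint x y) y))) ((e₃ : ℝ) ^ (-saddlePoint x y) * (x ^ saddlePoint x y * smoothZeta (saddlePoint x y) y /
            Real.sqrt (2 * Real.pi * saddlePhi₂ (saddlePoint x y) y))) (saddlePoint x y) c₁ c₂ c₃‖ ≤
      (e₃ : ℝ) * (((e₁ : ℝ) ^ (-saddlePoint x y) * (x ^ saddlePoint x y * smoothZeta (saddlePoint x y) y /
            Real.sqrt (2 * Real.pi * saddlePhi₂ (saddlePoint x y) y))) *
          ((e₂ : ℝ) ^ (-saddlePoint x y) * (x ^ saddlePoint x y * smoothZeta (saddlePoint x y) y /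
            Real.sqrt (2 * Real.pi * saddlePhi₂ (saddlePoint x y) y))) *
          ((e₃ : ℝ) ^ (-saddlePoint x y) * (x ^ saddlePoint x y * smoothZeta (saddlePoint x y) y /
            Real.sqrt (2 * Real.pi * saddlePhi₂ (saddlePoint x y) y)))) *
        (P ^ 3 * H * (331 * η * (28 + 16 * Real.log (2 * eB)) +
            100 * (eB / (3 * R) + 8 * D * (1 + 2 * eB * (1 + Real.log (2 * x))) / x)) +
          2316 * R * (3 * (11 * P + 1) ^ 2 * Δ * H + 375 * (11 * P + 2) ^ 2 * W * (R : ℝ) ^ 8) +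
          48 * D ^ 2 * P ^ 3 * ((R : ℝ) + 1) ^ (-(1 / 6 : ℝ))) := by
  have hx0 : 0 < x := by linarith
  obtain ⟨he₁0, he₂0, he₃0⟩ : (0 : ℝ) < e₁ ∧ (0 : ℝ) < e₂ ∧ (0 : ℝ) < e₃ :=
    ⟨by exact_mod_cast he₁, by exact_mod_cast he₂, by exact_mod_cast he₃⟩
  obtain ⟨he₁1, he₂1, he₃1⟩ : (1 : ℝ) ≤ e₁ ∧ (1 : ℝ) ≤ e₂ ∧ (1 : ℝ) ≤ e₃ :=
    ⟨by exact_mod_cast he₁, by exact_mod_cast he₂, by exact_mod_cast he₃⟩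
  have heB1 : 1 ≤ eB := he₁1.trans heB₁
  have heB0 : 0 < eB := by linarith
  have hD0 : 0 ≤ D := le_trans (Nat.cast_nonneg _) hd₁D
  have hlog2x : 0 ≤ Real.log (2 * x) := Real.log_nonneg (by linarith)
  have hlog2eB : 0 ≤ Real.log (2 * eB) := Real.log_nonneg (by linarith)
  obtain ⟨hex₁, hex₂, hex₃⟩ : (e₁ : ℝ) ≤ x ∧ (e₂ : ℝ) ≤ x ∧ (e₃ : ℝ) ≤ x :=
    ⟨heB₁.trans heBx, heB₂.trans heBx, heB₃.trans heBx⟩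
  have hd₁0 : d₁ ≠ 0 := by omega
  have hmaj := parity_major_arcs hx hy hα hα1 hΛ hη0 hη1 hε₀ hC hW hF hσ he₁ he₂ he₃ hex₁ hex₂ hex₃ hΛ₁ hΛ₂ hΛ₃
    hd₁0 hd₁e hd₂o hd₁ hd₂ hN hcop hR2 hRy hRx hxRN hΛR hE₁ hE₂ hE₃ hc₁ hc₂ hc₃
  refine hmaj.trans ?_
  clear hmaj hW hF
  have hR1 : (1 : ℝ) ≤ R := by exact_mod_cast (by omega : 1 ≤ R)
  -- ### the lattice and off-arc factors (`SmoothParityMajorArcsFlatTools`)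
  have hLAT := lat_factor_le (N₀ := (N₀ : ℝ)) hx0 he₁ he₃ heB₁ heB₃ hd₁1 hd₁ hxN hN2
  have hOFF := off_factor_le (N₀ := (N₀ : ℝ)) (R := (R : ℝ)) hx.le he₁ he₃ heB₁ hd₁1 hd₁D hR1 hxN hN2
  -- ### names (then `clear_value`, keeping the defining equations)
  set α : ℝ := saddlePoint x y with hα'
  have hα0 : 0 < α := saddlePoint_pos hx hy
  set X₁ : ℝ := x / e₁ with hX₁'
  set X₂ : ℝ := x / e₂ with hX₂'
  set X₃ : ℝ := x / e₃ with hX₃'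
  obtain ⟨hX₁0, hX₂0, hX₃0⟩ : 0 < X₁ ∧ 0 < X₂ ∧ 0 < X₃ :=
    ⟨div_pos hx0 he₁0, div_pos hx0 he₂0, div_pos hx0 he₃0⟩
  obtain ⟨hX₁x, hX₂x, hX₃x⟩ : X₁ ≤ x ∧ X₂ ≤ x ∧ X₃ ≤ x :=
    ⟨div_le_self hx0.le he₁1, div_le_self hx0.le he₂1, div_le_self hx0.le he₃1⟩
  have hφ0 : 0 < saddlePhi₂ α y := saddlePhi₂_pos hy hα0
  set Z₀ : ℝ := Real.sqrt (2 * Real.pi * saddlePhi₂ α y) with hZ₀'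
  have hZ₀0 : 0 < Z₀ := Real.sqrt_pos.2 (by positivity)
  have hZ₀Φ : Z₀ ≤ Real.sqrt (2 * Real.pi * Φ) := Real.sqrt_le_sqrt (mul_le_mul_of_nonneg_left hΦ (by positivity))
  have hζ0 : 0 < smoothZeta α y := smoothZeta_pos hα0
  set M₀ : ℝ := x ^ α * smoothZeta α y / Z₀ with hM₀'
  have hM₀0 : 0 < M₀ := div_pos (mul_pos (Real.rpow_pos_of_pos hx0 _) hζ0) hZ₀0
  set m₁ : ℝ := (e₁ : ℝ) ^ (-α) * M₀ with hm₁'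
  set m₂ : ℝ := (e₂ : ℝ) ^ (-α) * M₀ with hm₂'
  set m₃ : ℝ := (e₃ : ℝ) ^ (-α) * M₀ with hm₃'
  obtain ⟨hm₁0, hm₂0, hm₃0⟩ : 0 < m₁ ∧ 0 < m₂ ∧ 0 < m₃ :=
    ⟨mul_pos (Real.rpow_pos_of_pos he₁0 _) hM₀0, mul_pos (Real.rpow_pos_of_pos he₂0 _) hM₀0,
      mul_pos (Real.rpow_pos_of_pos he₃0 _) hM₀0⟩
  set S₁ : ℝ := ∑' ℓ : ℤ, ‖c₁ ℓ‖ * (1 + |(ℓ : ℝ)|) with hS₁'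
  set S₂ : ℝ := ∑' ℓ : ℤ, ‖c₂ ℓ‖ * (1 + |(ℓ : ℝ)|) with hS₂'
  set S₃ : ℝ := ∑' ℓ : ℤ, ‖c₃ ℓ‖ * (1 + |(ℓ : ℝ)|) with hS₃'
  obtain ⟨hS₁, hS₂, hS₃⟩ : 0 ≤ S₁ ∧ 0 ≤ S₂ ∧ 0 ≤ S₃ :=
    ⟨tsum_nonneg fun ℓ => by positivity, tsum_nonneg fun ℓ => by positivity, tsum_nonneg fun ℓ => by positivity⟩
  obtain ⟨hS₁P, hS₂P, hS₃P⟩ : S₁ ≤ P ∧ S₂ ≤ P ∧ S₃ ≤ P :=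
    ⟨(tsum_norm_mul_le_profileNorm hc₁).trans hP₁, (tsum_norm_mul_le_profileNorm hc₂).trans hP₂,
      (tsum_norm_mul_le_profileNorm hc₃).trans hP₃⟩
  obtain ⟨hpN₁, hpN₂, hpN₃⟩ := And.intro (profileNorm_nonneg c₁) (And.intro (profileNorm_nonneg c₂) (profileNorm_nonneg c₃))
  have hP0 : 0 ≤ P := hpN₁.trans hP₁
  set H₃ : ℝ := ∑ k ∈ Icc 1 R, ∑ a ∈ (Finset.range k).filter (Nat.Coprime k),
    classLocalHc α 2 1 k (d₁ * a) * classLocalHc α 2 1 k (σ * (d₂ * a)) * classLocalHc α 1 0 k a with hH₃'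
  set Hp : ℝ := ∑ k ∈ Icc 1 R, ∑ a ∈ (Finset.range k).filter (Nat.Coprime k),
    (1 + classLocalHc α 2 1 k (d₁ * a)) * (1 + classLocalHc α 2 1 k (σ * (d₂ * a))) * (1 + classLocalHc α 1 0 k a)
    with hHp'
  set δ₁ : ℝ := 12 * (1 + Λ) * S₁ / X₁ + 16 * profileNorm c₁ / Λ ^ 3 with hδ₁'
  set δ₂ : ℝ := 12 * (1 + Λ) * S₂ / X₂ + 16 * profileNorm c₂ / Λ ^ 3 with hδ₂'
  set δ₃ : ℝ := 12 * (1 + Λ) * S₃ / X₃ + 16 * profileNorm c₃ / Λ ^ 3 with hδ₃'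
  set w₁ : ℝ := ((2 * R : ℝ) * C_F * X₁ ^ (1 / 2 + ε₀) * (2 * R : ℝ) ^ ε₀ * (1 + Λ) ^ 3 +
    16 * ((Nat.smoothNumbersUpTo ⌊X₁⌋₊ (y + 1)).card : ℝ) / Λ ^ 3) * profileNorm c₁ with hw₁'
  set w₂ : ℝ := ((2 * R : ℝ) * C_F * X₂ ^ (1 / 2 + ε₀) * (2 * R : ℝ) ^ ε₀ * (1 + Λ) ^ 3 +
    16 * ((Nat.smoothNumbersUpTo ⌊X₂⌋₊ (y + 1)).card : ℝ) / Λ ^ 3) * profileNorm c₂ with hw₂'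
  set w₃ : ℝ := ((2 * R : ℝ) * C_F * X₃ ^ (1 / 2 + ε₀) * (2 * R : ℝ) ^ ε₀ * (1 + Λ) ^ 3 +
    16 * ((Nat.smoothNumbersUpTo ⌊X₃⌋₊ (y + 1)).card : ℝ) / Λ ^ 3) * profileNorm c₃ with hw₃'
  clear_value w₁ w₂ w₃ δ₁ δ₂ δ₃ Hp H₃ S₁ S₂ S₃ m₁ m₂ m₃ M₀ Z₀ X₁ X₂ X₃ α
  have hR0 : (0 : ℝ) < R := by linarith
  obtain ⟨hδ₁0, hδ₂0, hδ₃0⟩ : 0 ≤ δ₁ ∧ 0 ≤ δ₂ ∧ 0 ≤ δ₃ :=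
    ⟨by rw [hδ₁']; positivity, by rw [hδ₂']; positivity, by rw [hδ₃']; positivity⟩
  obtain ⟨hw₁0, hw₂0, hw₃0⟩ : 0 ≤ w₁ ∧ 0 ≤ w₂ ∧ 0 ≤ w₃ :=
    ⟨by rw [hw₁']; positivity, by rw [hw₂']; positivity, by rw [hw₃']; positivity⟩
  have hH₃0 : 0 ≤ H₃ := by
    rw [hH₃']
    exact Finset.sum_nonneg fun k _ => Finset.sum_nonneg fun a _ =>
      mul_nonneg (mul_nonneg (classLocalHc_nonneg α 2 1 k _) (classLocalHc_nonneg α 2 1 k _)) (classLocalHc_nonneg α 1 0 k _)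
  have hH0 : 0 ≤ H := hH₃0.trans hH
  have hHp0 : 0 ≤ Hp := by
    rw [hHp']
    exact Finset.sum_nonneg fun k _ => Finset.sum_nonneg fun a _ =>
      mul_nonneg (mul_nonneg (add_nonneg zero_le_one (classLocalHc_nonneg α 2 1 k _))
        (add_nonneg zero_le_one (classLocalHc_nonneg α 2 1 k _))) (add_nonneg zero_le_one (classLocalHc_nonneg α 1 0 k _))
  have hHpR : Hp ≤ 125 * (R : ℝ) ^ 8 := by
    rw [hHp']
    exact (parityHcSumPlus_le hα0.le σ d₁ d₂ R).trans (sq_mul_one_add_four_sq_cube_le hR1)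
  -- `m_i ≥ G₀/e_B`
  have hmlow : ∀ {e : ℕ}, 1 ≤ e → (e : ℝ) ≤ eB → G₀ / eB ≤ (e : ℝ) ^ (-α) * M₀ := by
    intro e he heB
    have he1 : (1 : ℝ) ≤ e := by exact_mod_cast he
    have h1 : (e : ℝ) ^ (-(1 : ℝ)) ≤ (e : ℝ) ^ (-α) := Real.rpow_le_rpow_of_exponent_le he1 (by linarith)
    rw [Real.rpow_neg_one] at h1
    calc G₀ / eB = eB⁻¹ * G₀ := by rw [div_eq_inv_mul]
      _ ≤ (e : ℝ)⁻¹ * M₀ := mul_le_mul ((inv_le_inv₀ (by linarith) (by linarith)).2 heB) hGM hG₀.le (by positivity)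
      _ ≤ (e : ℝ) ^ (-α) * M₀ := mul_le_mul_of_nonneg_right h1 hM₀0.le
  have hN0 : (0 : ℝ) < N₀ := by linarith
  have hρN : 96 * R / x * N₀ + 1 ≤ 193 * R := by
    have h1 : 96 * R / x * N₀ ≤ 96 * R / x * (2 * x) := mul_le_mul_of_nonneg_left hN2 (by positivity)
    have h2 : 96 * R / x * (2 * x) = 192 * R := by field_simp; ring
    linarith
  have hρN0 : 0 ≤ 96 * R / x * N₀ + 1 := by positivity
  -- ### `PMS ≤ Mv₁Mv₂Mv₃ P³`
  have hPMS : (m₁ * S₁) * (m₂ * S₂) * (m₃ * S₃) ≤ m₁ * m₂ * m₃ * P ^ 3 := by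
    have : S₁ * S₂ * S₃ ≤ P * P * P := mul_le_mul (mul_le_mul hS₁P hS₂P hS₂ hP0) hS₃P hS₃ (by positivity)
    calc (m₁ * S₁) * (m₂ * S₂) * (m₃ * S₃) = m₁ * m₂ * m₃ * (S₁ * S₂ * S₃) := by ring
      _ ≤ m₁ * m₂ * m₃ * (P * P * P) := mul_le_mul_of_nonneg_left this (by positivity)
      _ = _ := by ring
  have hPMS0 : 0 ≤ (m₁ * S₁) * (m₂ * S₂) * (m₃ * S₃) := by positivity
  -- ### the relative flat errors `δ_i ≤ Δ`
  have hδ : ∀ {e : ℕ} {S p : ℝ}, 1 ≤ e → (e : ℝ) ≤ eB → 0 ≤ S → S ≤ P → p ≤ P →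
      12 * (1 + Λ) * S / (x / e) + 16 * p / Λ ^ 3 ≤ Δ := by
    intro e S p he heB hS0 hSP hpP
    have he0 : (0 : ℝ) < e := by exact_mod_cast (show 0 < e by omega)
    refine le_trans (add_le_add ?_ (div_le_div_of_nonneg_right (by linarith) (by positivity))) hΔ
    rw [div_div_eq_mul_div]
    refine div_le_div_of_nonneg_right ?_ hx0.le
    calc 12 * (1 + Λ) * S * e ≤ 12 * (1 + Λ) * P * eB := mul_le_mul (by gcongr) heB he0.le (by positivity)
      _ = _ := by ring
  have hΔ0 : 0 ≤ Δ := le_trans (by positivity) (hδ he₁ heB₁ hS₁ hS₁P hP₁)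
  -- ### the GRH/transfer flat errors `w_i ≤ m_i W`
  have hw : ∀ {e : ℕ} {c : ℤ → ℂ}, 1 ≤ e → (e : ℝ) ≤ eB → profileNorm c ≤ P →
      ((2 * R : ℝ) * C_F * (x / e) ^ (1 / 2 + ε₀) * (2 * R : ℝ) ^ ε₀ * (1 + Λ) ^ 3 +
        16 * ((Nat.smoothNumbersUpTo ⌊x / e⌋₊ (y + 1)).card : ℝ) / Λ ^ 3) * profileNorm c ≤ ((e : ℝ) ^ (-α) * M₀) * W := by
    intro e c he heB hpP
    have he0 : (0 : ℝ) < e := by exact_mod_cast (show 0 < e by omega)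
    have he1 : (1 : ℝ) ≤ e := by exact_mod_cast he
    have hm0 : 0 < (e : ℝ) ^ (-α) * M₀ := mul_pos (Real.rpow_pos_of_pos he0 _) hM₀0
    have hml : G₀ / eB ≤ (e : ℝ) ^ (-α) * M₀ := hmlow he heB
    -- Rankin at the master saddle point: `#S(x/e, y) ≤ e^{−α}x^αζ = m Z₀`
    have hΨ : ((Nat.smoothNumbersUpTo ⌊x / e⌋₊ (y + 1)).card : ℝ) ≤ (e : ℝ) ^ (-α) * M₀ * Real.sqrt (2 * Real.pi * Φ) := by
      have h1 := card_smoothNumbersUpTo_div_nat_le_rankin_saddlePoint (y := y) hx hy he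
      rw [← hα'] at h1
      have heq : (e : ℝ) ^ (-α) * (x ^ α * smoothZeta α y) = (e : ℝ) ^ (-α) * M₀ * Z₀ := by
        rw [hM₀', mul_assoc, div_mul_cancel₀ _ hZ₀0.ne']
      rw [heq] at h1
      exact h1.trans (mul_le_mul_of_nonneg_left hZ₀Φ hm0.le)
    have hXe : (x / e) ^ (1 / 2 + ε₀) ≤ x ^ (1 / 2 + ε₀) :=
      Real.rpow_le_rpow (by positivity) (div_le_self hx0.le he1) (by linarith)
    have hpc : 0 ≤ profileNorm c := profileNorm_nonneg c
    calc ((2 * R : ℝ) * C_F * (x / e) ^ (1 / 2 + ε₀) * (2 * R : ℝ) ^ ε₀ * (1 + Λ) ^ 3 +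
          16 * ((Nat.smoothNumbersUpTo ⌊x / e⌋₊ (y + 1)).card : ℝ) / Λ ^ 3) * profileNorm c
        ≤ ((2 * R : ℝ) * C_F * x ^ (1 / 2 + ε₀) * (2 * R : ℝ) ^ ε₀ * (1 + Λ) ^ 3 +
          16 * ((e : ℝ) ^ (-α) * M₀ * Real.sqrt (2 * Real.pi * Φ)) / Λ ^ 3) * P := by
          gcongr
      _ = ((2 * R : ℝ) * C_F * x ^ (1 / 2 + ε₀) * (2 * R : ℝ) ^ ε₀ * (1 + Λ) ^ 3 * P) * 1 +
          ((e : ℝ) ^ (-α) * M₀) * (16 * Real.sqrt (2 * Real.pi * Φ) * P / Λ ^ 3) := by ring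
      _ ≤ ((2 * R : ℝ) * C_F * x ^ (1 / 2 + ε₀) * (2 * R : ℝ) ^ ε₀ * (1 + Λ) ^ 3 * P) * (((e : ℝ) ^ (-α) * M₀) * (eB / G₀)) +
          ((e : ℝ) ^ (-α) * M₀) * (16 * Real.sqrt (2 * Real.pi * Φ) * P / Λ ^ 3) := by
          gcongr
          rw [← div_le_iff₀ (by positivity), one_div_div]
          exact hml
      _ = ((e : ℝ) ^ (-α) * M₀) * (2 * R * C_F * x ^ (1 / 2 + ε₀) * (2 * R : ℝ) ^ ε₀ * (1 + Λ) ^ 3 * P * eB / G₀ +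
          16 * Real.sqrt (2 * Real.pi * Φ) * P / Λ ^ 3) := by ring
      _ ≤ ((e : ℝ) ^ (-α) * M₀) * W := mul_le_mul_of_nonneg_left hWW hm0.le
  have hW0 : 0 ≤ W := by
    have h := hw (c := c₁) he₁ heB₁ hP₁
    have h0 : 0 ≤ ((2 * R : ℝ) * C_F * (x / e₁) ^ (1 / 2 + ε₀) * (2 * R : ℝ) ^ ε₀ * (1 + Λ) ^ 3 +
        16 * ((Nat.smoothNumbersUpTo ⌊x / e₁⌋₊ (y + 1)).card : ℝ) / Λ ^ 3) * profileNorm c₁ := by positivity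
    exact nonneg_of_mul_nonneg_right (h0.trans h) (mul_pos (Real.rpow_pos_of_pos he₁0 _) hM₀0)
  -- ### the flat errors `C₂ ≤ m·3(11P+1)²Δ`, `C₁ ≤ m·3(11P+2)²W`
  obtain ⟨hδ₁Δ, hδ₂Δ, hδ₃Δ⟩ : δ₁ ≤ Δ ∧ δ₂ ≤ Δ ∧ δ₃ ≤ Δ :=
    ⟨by rw [hδ₁', hX₁']; exact hδ he₁ heB₁ hS₁ hS₁P hP₁, by rw [hδ₂', hX₂']; exact hδ he₂ heB₂ hS₂ hS₂P hP₂,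
      by rw [hδ₃', hX₃']; exact hδ he₃ heB₃ hS₃ hS₃P hP₃⟩
  obtain ⟨hw₁W, hw₂W, hw₃W⟩ : w₁ ≤ m₁ * W ∧ w₂ ≤ m₂ * W ∧ w₃ ≤ m₃ * W :=
    ⟨by rw [hw₁', hm₁', hX₁']; exact hw he₁ heB₁ hP₁, by rw [hw₂', hm₂', hX₂']; exact hw he₂ heB₂ hP₂,
      by rw [hw₃', hm₃', hX₃']; exact hw he₃ heB₃ hP₃⟩
  have hC₂ : (m₁ * (11 * S₁ + δ₁)) * (m₂ * (11 * S₂ + δ₂)) * (m₃ * (11 * S₃ + δ₃)) -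
      11 * (m₁ * S₁) * (11 * (m₂ * S₂)) * (11 * (m₃ * S₃)) ≤ m₁ * m₂ * m₃ * (3 * (11 * P + 1) ^ 2 * Δ) := by
    have h := prod3_sub_prod3_le (A := 11 * P) (T := Δ) (a₁ := 11 * S₁) (a₂ := 11 * S₂) (a₃ := 11 * S₃)
      (t₁ := δ₁) (t₂ := δ₂) (t₃ := δ₃) (by positivity) (by positivity) (by positivity)
      (by linarith) (by linarith) (by linarith) hδ₁0 hδ₂0 hδ₃0 hδ₁Δ hδ₂Δ hδ₃Δ
    have hb : 11 * P + Δ ≤ 11 * P + 1 := by linarith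
    have h2 : 3 * (11 * P + Δ) ^ 2 * Δ ≤ 3 * (11 * P + 1) ^ 2 * Δ :=
      mul_le_mul_of_nonneg_right (mul_le_mul_of_nonneg_left (pow_le_pow_left₀ (by positivity) hb 2) (by norm_num)) hΔ0
    calc _ = m₁ * m₂ * m₃ * ((11 * S₁ + δ₁) * (11 * S₂ + δ₂) * (11 * S₃ + δ₃) - 11 * S₁ * (11 * S₂) * (11 * S₃)) := by ring
      _ ≤ m₁ * m₂ * m₃ * (3 * (11 * P + 1) ^ 2 * Δ) := mul_le_mul_of_nonneg_left (h.trans h2) (by positivity)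
  have hC₁ : (m₁ * (11 * S₁ + δ₁) + w₁) * (m₂ * (11 * S₂ + δ₂) + w₂) * (m₃ * (11 * S₃ + δ₃) + w₃) -
      (m₁ * (11 * S₁ + δ₁)) * (m₂ * (11 * S₂ + δ₂)) * (m₃ * (11 * S₃ + δ₃)) ≤ m₁ * m₂ * m₃ * (3 * (11 * P + 2) ^ 2 * W) := by
    obtain ⟨ω₁, hω₁0, hω₁W, hw₁e⟩ : ∃ ω : ℝ, 0 ≤ ω ∧ ω ≤ W ∧ w₁ = m₁ * ω :=
      ⟨w₁ / m₁, div_nonneg hw₁0 hm₁0.le, (div_le_iff₀' hm₁0).2 hw₁W, (mul_div_cancel₀ w₁ hm₁0.ne').symm⟩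
    obtain ⟨ω₂, hω₂0, hω₂W, hw₂e⟩ : ∃ ω : ℝ, 0 ≤ ω ∧ ω ≤ W ∧ w₂ = m₂ * ω :=
      ⟨w₂ / m₂, div_nonneg hw₂0 hm₂0.le, (div_le_iff₀' hm₂0).2 hw₂W, (mul_div_cancel₀ w₂ hm₂0.ne').symm⟩
    obtain ⟨ω₃, hω₃0, hω₃W, hw₃e⟩ : ∃ ω : ℝ, 0 ≤ ω ∧ ω ≤ W ∧ w₃ = m₃ * ω :=
      ⟨w₃ / m₃, div_nonneg hw₃0 hm₃0.le, (div_le_iff₀' hm₃0).2 hw₃W, (mul_div_cancel₀ w₃ hm₃0.ne').symm⟩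
    rw [hw₁e, hw₂e, hw₃e]
    have h := prod3_sub_prod3_le (A := 11 * P + Δ) (T := W) (a₁ := 11 * S₁ + δ₁) (a₂ := 11 * S₂ + δ₂) (a₃ := 11 * S₃ + δ₃)
      (t₁ := ω₁) (t₂ := ω₂) (t₃ := ω₃) (by positivity) (by positivity) (by positivity)
      (by linarith) (by linarith) (by linarith) hω₁0 hω₂0 hω₃0 hω₁W hω₂W hω₃W
    have hb : 11 * P + Δ + W ≤ 11 * P + 2 := by linarith
    have h2 : 3 * (11 * P + Δ + W) ^ 2 * W ≤ 3 * (11 * P + 2) ^ 2 * W :=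
      mul_le_mul_of_nonneg_right (mul_le_mul_of_nonneg_left (pow_le_pow_left₀ (by positivity) hb 2) (by norm_num)) hW0
    calc _ = m₁ * m₂ * m₃ * ((11 * S₁ + δ₁ + ω₁) * (11 * S₂ + δ₂ + ω₂) * (11 * S₃ + δ₃ + ω₃) -
          (11 * S₁ + δ₁) * (11 * S₂ + δ₂) * (11 * S₃ + δ₃)) := by ring
      _ ≤ _ := mul_le_mul_of_nonneg_left (h.trans h2) (by positivity)
  have hC₂0 : 0 ≤ (m₁ * (11 * S₁ + δ₁)) * (m₂ * (11 * S₂ + δ₂)) * (m₃ * (11 * S₃ + δ₃)) -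
      11 * (m₁ * S₁) * (11 * (m₂ * S₂)) * (11 * (m₃ * S₃)) := by
    have h1 := eleven_mul_le (S := S₁) hm₁0.le hδ₁0
    have h2 := eleven_mul_le (S := S₂) hm₂0.le hδ₂0
    have h3 := eleven_mul_le (S := S₃) hm₃0.le hδ₃0
    have := mul_le_mul (mul_le_mul h1 h2 (by positivity) (by positivity)) h3 (by positivity) (by positivity)
    linarith
  -- ### the tail
  have hTAIL := tail_factor_le (D := D) hα4 hα1 hd₁1 hd₂1 hd₁D hd₂D R
  have hTAIL0 : 0 ≤ 3 * ((d₁ * d₂ : ℕ) : ℝ) ^ α * Real.exp (2420 * (1 - α) / (3 * α - 13 / 5 - (3 * α - 13 / 5) / 2)) *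
      ((R + 1 : ℕ) : ℝ) ^ (-((3 * α - 13 / 5) / 2)) := by positivity
  have hNPX : (N₀ : ℝ) * (((m₁ * S₁) * (m₂ * S₂) * (m₃ * S₃)) / X₃) ≤ 2 * e₃ * (m₁ * m₂ * m₃ * P ^ 3) := by
    rw [← mul_div_assoc, hX₃', div_le_iff₀ (by positivity)]
    calc (N₀ : ℝ) * ((m₁ * S₁) * (m₂ * S₂) * (m₃ * S₃)) ≤ (2 * x) * (m₁ * m₂ * m₃ * P ^ 3) :=
          mul_le_mul hN2 hPMS hPMS0 (by positivity)
      _ = 2 * e₃ * (m₁ * m₂ * m₃ * P ^ 3) * (x / e₃) := by field_simp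
  -- ### assemble
  have key1 : (331 * η * ((m₁ * S₁) * (m₂ * S₂) * (m₃ * S₃)) *
        (4 * (1 + (N₀ : ℝ) / X₃ * (3 + |Real.log (X₃ / N₀)| + |Real.log ((d₁ : ℝ) * X₁ / N₀)|))) +
      100 * ((m₁ * S₁) * (m₂ * S₂) * (m₃ * S₃)) *
        (16 * N₀ / (X₃ * ((d₁ : ℝ) * X₁) * (96 * R / x)) + 2 * d₁ / X₃ * (4 * (1 + (N₀ : ℝ) / X₁ * (1 + Real.log N₀)))) +
      12 * (96 * R / x * N₀ + 1) * ((m₁ * (11 * S₁ + δ₁)) * (m₂ * (11 * S₂ + δ₂)) * (m₃ * (11 * S₃ + δ₃)) -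
        11 * (m₁ * S₁) * (11 * (m₂ * S₂)) * (11 * (m₃ * S₃)))) * H₃ ≤
      (e₃ : ℝ) * (m₁ * m₂ * m₃) * (P ^ 3 * H * (331 * η * (28 + 16 * Real.log (2 * eB)) +
        100 * (eB / (3 * R) + 8 * D * (1 + 2 * eB * (1 + Real.log (2 * x))) / x)) + 2316 * R * (3 * (11 * P + 1) ^ 2 * Δ * H)) := by
    have hA : 331 * η * ((m₁ * S₁) * (m₂ * S₂) * (m₃ * S₃)) *
        (4 * (1 + (N₀ : ℝ) / X₃ * (3 + |Real.log (X₃ / N₀)| + |Real.log ((d₁ : ℝ) * X₁ / N₀)|))) ≤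
        331 * η * (m₁ * m₂ * m₃ * P ^ 3) * ((e₃ : ℝ) * (28 + 16 * Real.log (2 * eB))) :=
      mul_le_mul (mul_le_mul_of_nonneg_left hPMS (by positivity)) hLAT (by positivity) (by positivity)
    have hB : 100 * ((m₁ * S₁) * (m₂ * S₂) * (m₃ * S₃)) *
        (16 * N₀ / (X₃ * ((d₁ : ℝ) * X₁) * (96 * R / x)) + 2 * d₁ / X₃ * (4 * (1 + (N₀ : ℝ) / X₁ * (1 + Real.log N₀)))) ≤
        100 * (m₁ * m₂ * m₃ * P ^ 3) * ((e₃ : ℝ) * (eB / (3 * R) + 8 * D * (1 + 2 * eB * (1 + Real.log (2 * x))) / x)) :=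
      mul_le_mul (mul_le_mul_of_nonneg_left hPMS (by positivity)) hOFF (by positivity) (by positivity)
    have hCC : 12 * (96 * R / x * N₀ + 1) * ((m₁ * (11 * S₁ + δ₁)) * (m₂ * (11 * S₂ + δ₂)) * (m₃ * (11 * S₃ + δ₃)) -
        11 * (m₁ * S₁) * (11 * (m₂ * S₂)) * (11 * (m₃ * S₃))) ≤
        12 * (193 * R) * ((e₃ : ℝ) * (m₁ * m₂ * m₃ * (3 * (11 * P + 1) ^ 2 * Δ))) :=
      mul_le_mul (by linarith) (hC₂.trans (le_mul_of_one_le_left (by positivity) he₃1)) hC₂0 (by positivity)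
    have hsum := add_le_add (add_le_add hA hB) hCC
    calc _ ≤ (331 * η * (m₁ * m₂ * m₃ * P ^ 3) * ((e₃ : ℝ) * (28 + 16 * Real.log (2 * eB))) +
          100 * (m₁ * m₂ * m₃ * P ^ 3) * ((e₃ : ℝ) * (eB / (3 * R) + 8 * D * (1 + 2 * eB * (1 + Real.log (2 * x))) / x)) +
          12 * (193 * R) * ((e₃ : ℝ) * (m₁ * m₂ * m₃ * (3 * (11 * P + 1) ^ 2 * Δ)))) * H :=
          mul_le_mul hsum hH hH₃0 (by positivity)
      _ = _ := by ring
  have key2 : 12 * (96 * R / x * N₀ + 1) * ((m₁ * (11 * S₁ + δ₁) + w₁) * (m₂ * (11 * S₂ + δ₂) + w₂) * (m₃ * (11 * S₃ + δ₃) + w₃) -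
        (m₁ * (11 * S₁ + δ₁)) * (m₂ * (11 * S₂ + δ₂)) * (m₃ * (11 * S₃ + δ₃))) * Hp ≤
      (e₃ : ℝ) * (m₁ * m₂ * m₃) * (2316 * R * (375 * (11 * P + 2) ^ 2 * W * (R : ℝ) ^ 8)) := by
    have hC₁0 : 0 ≤ (m₁ * (11 * S₁ + δ₁) + w₁) * (m₂ * (11 * S₂ + δ₂) + w₂) * (m₃ * (11 * S₃ + δ₃) + w₃) -
        (m₁ * (11 * S₁ + δ₁)) * (m₂ * (11 * S₂ + δ₂)) * (m₃ * (11 * S₃ + δ₃)) := by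
      have := prod_three_mono (W₁ := w₁) (W₂ := w₂) (W₃ := w₃) (w₁ := 0) (w₂ := 0) (w₃ := 0)
        (by positivity : 0 ≤ m₁ * (11 * S₁ + δ₁)) (by positivity : 0 ≤ m₂ * (11 * S₂ + δ₂))
        (by positivity : 0 ≤ m₃ * (11 * S₃ + δ₃)) le_rfl le_rfl le_rfl hw₁0 hw₂0 hw₃0
      simp only [add_zero] at this
      linarith
    calc _ ≤ 12 * (193 * R) * (m₁ * m₂ * m₃ * (3 * (11 * P + 2) ^ 2 * W)) * (125 * (R : ℝ) ^ 8) :=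
          mul_le_mul (mul_le_mul (by linarith) hC₁ hC₁0 (by positivity)) hHpR hHp0 (by positivity)
      _ ≤ 12 * (193 * R) * (m₁ * m₂ * m₃ * (3 * (11 * P + 2) ^ 2 * W)) * (125 * (R : ℝ) ^ 8) * e₃ :=
          le_mul_of_one_le_right (by positivity) he₃1
      _ = _ := by ring
  have key3 : 3 * ((d₁ * d₂ : ℕ) : ℝ) ^ α * Real.exp (2420 * (1 - α) / (3 * α - 13 / 5 - (3 * α - 13 / 5) / 2)) *
        ((R + 1 : ℕ) : ℝ) ^ (-((3 * α - 13 / 5) / 2)) * ((N₀ : ℝ) * (((m₁ * S₁) * (m₂ * S₂) * (m₃ * S₃)) / X₃)) ≤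
      (e₃ : ℝ) * (m₁ * m₂ * m₃) * (48 * D ^ 2 * P ^ 3 * ((R : ℝ) + 1) ^ (-(1 / 6 : ℝ))) := by
    calc _ ≤ 24 * D ^ 2 * ((R : ℝ) + 1) ^ (-(1 / 6 : ℝ)) * (2 * e₃ * (m₁ * m₂ * m₃ * P ^ 3)) :=
          mul_le_mul hTAIL hNPX (by positivity) (by positivity)
      _ = _ := by ring
  have htot := add_le_add (add_le_add key1 key2) key3
  refine htot.trans (le_of_eq ?_)
  ring

end SmoothArcs

end Literature.NumberTheory.Sieve

end
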